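import Summits.Ventures.YMGap.RobustBall.PairCoupling
import Summits.Ventures.YMGap.RobustBall.LatticeSumL1
import Summits.Ventures.YMGap.RobustBall.RowsS
import HarnessLib

/-!
# Venture YMGap, track ROBUST-BALL (tier 2) — the ISOTROPIC two-plaquette member: all pairs of plaquettes,
# coupling `τ κ^{‖x_p - x_q‖₁}`, with a certified `SU(2)` row

HONEST FRAMING. WHAT THIS IS: a venture file (cell `pub-ymgap`, track Y2 ROBUST-BALL, seat rb-p1): the
isotropic infinite-range member of the tier-2 ball. `isotropicPairWitness N τ κ = plaqPairCoupling N (isoJ τ κ)`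
couples EVERY ordered pair of plaquettes `(p, q)` of `ℤ^d` (all orientations, all relative positions,
including `p = q`) by `τ κ^{‖x_p - x_q‖₁} (Re tr U_p/N)(Re tr U_q/N)`. From the structural theorem
`memBallZdS_plaqPairCoupling` and the lattice sum `∑_x κ^{‖x‖₁} ≤ ((1+κ)/(1-κ))^d` we get, for `0 ≤ κ < 1`,
`0 ≤ t`, `κe^{t} < 1`, membership in `MemBallZdS a Λ t` with
`a = 8(d-1) D_d |τ| G_d(κ)`, `Λ = 16(d-1) D_d |τ| e^{t} (G_d(κ) + G_d(κe^{t}))/√N`,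
`D_d = #{plaquette orientations} = d(d-1)/2`, `G_d(r) = ((1+r)/(1-r))^d` (`memBallZdS_isotropicPairWitness`);
it lies in no tier-1 ball (`not_memBallZd_isotropicPairWitness`); and the `SU(2)`, `ℤ⁴` row: at `β_W = 1/16`,
`κ = 1/10`, `|τ| ≤ 1/10000` the perturbed theory has exactly one DLR state clustering at rate `log (3/2)`
(`su2_isotropicPair_massGapS_1_16`, inside row `su2_rowS32_1_16` of `RowsS.lean`). WHAT IT IS NOT: a
strong-coupling lattice statement; no claim about the continuum limit, asymptotic scaling, or the Clay
Millennium problem.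

References: `PairCoupling.lean`, `LatticeSumL1.lean`, `RowsS.lean` (this track).
-/

noncomputable section

open MeasureTheory Filter Function Topology Real Finset
open Literature.Probability.LatticeModels
open Literature.Probability.LatticeModels.DobrushinMetric
open Literature.MathematicalPhysics.QuantumLattice
open Literature.MathematicalPhysics.QuantumFieldTheory hiding ZdEdge

namespace Summit.Ventures.YMGap.RobustBall

variable {d N : ℕ}

/-! ### Plaquette sums from lattice-point sums -/

variable (d) in
/-- The number of plaquette orientations `{(i, j) : i < j}` in dimension `d` (`= d(d-1)/2`). -/
def numOrient : ℕ := Fintype.card {o : Fin d × Fin d // o.1 < o.2}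

/-- In four dimensions there are six plaquette orientations. -/
theorem numOrient_four : numOrient 4 = 6 := by
  unfold numOrient; decide

/-- A partial sum over plaquettes of a function of the base point is at most `numOrient d` times a bound on
the partial sums over base points. -/
theorem sum_plaquette_base_le {f : Site d → ℝ} (hf : ∀ x, 0 ≤ f x) {G : ℝ} (hG : ∀ F : Finset (Site d), ∑ x ∈ F, f x ≤ G)
    (S : Finset (ZdPlaquette d)) : ∑ q ∈ S, f q.1 ≤ numOrient d * G := by
  classical
  have hG0 : 0 ≤ G := le_trans (by simp) (hG ∅)
  have hsub : S ⊆ (S.image Prod.fst) ×ˢ (univ : Finset {o : Fin d × Fin d // o.1 < o.2}) :=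
    fun q hq => mem_product.2 ⟨mem_image.2 ⟨q, hq, rfl⟩, mem_univ _⟩
  calc ∑ q ∈ S, f q.1 ≤ ∑ q ∈ (S.image Prod.fst) ×ˢ (univ : Finset {o : Fin d × Fin d // o.1 < o.2}), f q.1 :=
        sum_le_sum_of_subset_of_nonneg hsub fun q _ _ => hf _
    _ = ∑ x ∈ S.image Prod.fst, (numOrient d : ℝ) * f x := by
        rw [sum_product]
        refine sum_congr rfl fun x _ => ?_
        change ∑ _o : {o : Fin d × Fin d // o.1 < o.2}, f x = _
        rw [sum_const, nsmul_eq_mul, card_univ, numOrient]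
    _ = numOrient d * ∑ x ∈ S.image Prod.fst, f x := by rw [mul_sum]
    _ ≤ numOrient d * G := mul_le_mul_of_nonneg_left (hG _) (Nat.cast_nonneg _)

/-! ### The isotropic coupling -/

/-- **The isotropic coupling** `J(p, q) = τ κ^{‖x_p - x_q‖₁}`. -/
def isoJ (τ κ : ℝ) (i : PlaqPairIdx d) : ℝ := τ * κ ^ l1 (i.1.1 - i.2.1)

variable {τ κ t : ℝ}

/-- `|J(p,q)| = |τ| κ^{‖x_p - x_q‖₁}` for `κ ≥ 0`. -/
theorem abs_isoJ (hκ : 0 ≤ κ) (i : PlaqPairIdx d) : |isoJ τ κ i| = |τ| * κ ^ l1 (i.1.1 - i.2.1) := by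
  rw [isoJ, abs_mul, abs_pow, abs_of_nonneg hκ]

/-- The weighted coupling is dominated by the `κe^{t}`-coupling:
`|J| e^{t(‖x_p-x_q‖∞+1)} ≤ |τ| e^{t} (κe^{t})^{‖x_p-x_q‖₁}` (`‖·‖∞ ≤ ‖·‖₁`, `t ≥ 0`). -/
theorem abs_isoJ_mul_exp_le (hκ : 0 ≤ κ) (ht : 0 ≤ t) (i : PlaqPairIdx d) :
    |isoJ τ κ i| * exp (t * (‖i.1.1 - i.2.1‖ + 1)) ≤ |τ| * exp t * (κ * exp t) ^ l1 (i.1.1 - i.2.1) := by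
  rw [abs_isoJ hκ]
  have hD : ‖i.1.1 - i.2.1‖ ≤ (l1 (i.1.1 - i.2.1) : ℝ) := norm_le_l1 _
  have hexp : exp (t * (‖i.1.1 - i.2.1‖ + 1)) ≤ exp t * exp t ^ l1 (i.1.1 - i.2.1) := by
    rw [← Real.exp_nat_mul, ← Real.exp_add]
    exact exp_le_exp.2 (by nlinarith [mul_le_mul_of_nonneg_left hD ht])
  calc |τ| * κ ^ l1 (i.1.1 - i.2.1) * exp (t * (‖i.1.1 - i.2.1‖ + 1))
      ≤ |τ| * κ ^ l1 (i.1.1 - i.2.1) * (exp t * exp t ^ l1 (i.1.1 - i.2.1)) :=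
        mul_le_mul_of_nonneg_left hexp (by positivity)
    _ = |τ| * exp t * (κ * exp t) ^ l1 (i.1.1 - i.2.1) := by rw [mul_pow]; ring

/-- **Row and column sums of the isotropic coupling**: for `0 ≤ r < 1` and every plaquette `p`,
`q ↦ c · r^{‖x_p - x_q‖₁}` is summable over all plaquettes with sum `≤ c · D_d · ((1+r)/(1-r))^d`; the same for
`p ↦ c · r^{‖x_p - x_q‖₁}` with `q` fixed. -/
theorem summable_and_tsum_row_le {r c : ℝ} (hc : 0 ≤ c) (h0 : 0 ≤ r) (h1 : r < 1) (p : ZdPlaquette d) :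
    (Summable fun q : ZdPlaquette d => c * r ^ l1 (p.1 - q.1)) ∧
      ∑' q : ZdPlaquette d, c * r ^ l1 (p.1 - q.1) ≤ c * (numOrient d * ((1 + r) / (1 - r)) ^ d) := by
  have hf0 : ∀ q : ZdPlaquette d, 0 ≤ c * r ^ l1 (p.1 - q.1) := fun q => by positivity
  have hS : ∀ S : Finset (ZdPlaquette d), ∑ q ∈ S, c * r ^ l1 (p.1 - q.1) ≤ c * (numOrient d * ((1 + r) / (1 - r)) ^ d) := by
    intro S
    rw [← mul_sum]
    exact mul_le_mul_of_nonneg_left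
      (sum_plaquette_base_le (f := fun x => r ^ l1 (p.1 - x)) (fun x => pow_nonneg h0 _) (sum_pow_l1_sub_le h0 h1 p.1) S) hc
  exact ⟨summable_of_sum_le hf0 hS, Real.tsum_le_of_sum_le hf0 hS⟩

/-- Column version (by the symmetry `‖x_p - x_q‖₁ = ‖x_q - x_p‖₁`). -/
theorem summable_and_tsum_col_le {r c : ℝ} (hc : 0 ≤ c) (h0 : 0 ≤ r) (h1 : r < 1) (q : ZdPlaquette d) :
    (Summable fun p : ZdPlaquette d => c * r ^ l1 (p.1 - q.1)) ∧
      ∑' p : ZdPlaquette d, c * r ^ l1 (p.1 - q.1) ≤ c * (numOrient d * ((1 + r) / (1 - r)) ^ d) := by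
  have h := summable_and_tsum_row_le (d := d) hc h0 h1 q
  simp_rw [l1_sub_comm q.1] at h
  exact h

/-! ### The member -/

variable (N) in
/-- **The isotropic two-plaquette member** `∑_{(p,q)} τ κ^{‖x_p - x_q‖₁} (Re tr U_p/N)(Re tr U_q/N)`. -/
def isotropicPairWitness (τ κ : ℝ) : Potential (ZdEdge d) (Matrix.specialUnitaryGroup (Fin N) ℂ) :=
  plaqPairCoupling N (isoJ τ κ)

/-- **THE ISOTROPIC MEMBER LIES IN THE WEIGHTED BALL** with loads
`a = 8(d-1) D_d |τ| G_d(κ)`, `Λ = 16(d-1) D_d |τ| e^{t} (G_d(κ) + G_d(κe^{t}))/√N`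
(`D_d = numOrient d`, `G_d(r) = ((1+r)/(1-r))^d`), for `0 ≤ κ < 1`, `0 ≤ t`, `κe^{t} < 1`. -/
theorem memBallZdS_isotropicPairWitness (hd : 1 ≤ d) (hN : 1 ≤ N) (hκ0 : 0 ≤ κ) (hκ1 : κ < 1) (ht : 0 ≤ t)
    (hκt : κ * exp t < 1) :
    MemBallZdS (8 * ((d : ℝ) - 1) * numOrient d * |τ| * ((1 + κ) / (1 - κ)) ^ d)
      (16 * ((d : ℝ) - 1) * numOrient d * |τ| * exp t *
        (((1 + κ) / (1 - κ)) ^ d + ((1 + κ * exp t) / (1 - κ * exp t)) ^ d) / Real.sqrt N) t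
      (isotropicPairWitness (d := d) N τ κ) := by
  have hκt0 : 0 ≤ κ * exp t := by positivity
  have hτ0 : 0 ≤ |τ| := abs_nonneg τ
  have hτt0 : 0 ≤ |τ| * exp t := by positivity
  -- unweighted rows/columns
  have hr0 := fun p : ZdPlaquette d => summable_and_tsum_row_le (d := d) hτ0 hκ0 hκ1 p
  have hc0 := fun q : ZdPlaquette d => summable_and_tsum_col_le (d := d) hτ0 hκ0 hκ1 q
  -- weighted rows/columns (dominated by the `κe^t`-coupling)
  have hrt := fun p : ZdPlaquette d => summable_and_tsum_row_le (d := d) hτt0 hκt0 hκt p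
  have hct := fun q : ZdPlaquette d => summable_and_tsum_col_le (d := d) hτt0 hκt0 hκt q
  have habs : ∀ i : PlaqPairIdx d, |isoJ τ κ i| = |τ| * κ ^ l1 (i.1.1 - i.2.1) := abs_isoJ hκ0
  have hw0 : ∀ i : PlaqPairIdx d, 0 ≤ |isoJ τ κ i| * exp (t * (‖i.1.1 - i.2.1‖ + 1)) := fun i => by positivity
  have hrow₀ : ∀ p : ZdPlaquette d, Summable fun q : ZdPlaquette d => |isoJ τ κ (p, q)| := fun p => by
    simp_rw [habs]; exact (hr0 p).1
  have hcol₀ : ∀ q : ZdPlaquette d, Summable fun p : ZdPlaquette d => |isoJ τ κ (p, q)| := fun q => by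
    simp_rw [habs]; exact (hc0 q).1
  have hrowt : ∀ p : ZdPlaquette d, Summable fun q : ZdPlaquette d =>
      |isoJ τ κ (p, q)| * exp (t * (‖p.1 - q.1‖ + 1)) := fun p =>
    Summable.of_nonneg_of_le (fun q => hw0 (p, q)) (fun q => abs_isoJ_mul_exp_le hκ0 ht (p, q)) (hrt p).1
  have hcolt : ∀ q : ZdPlaquette d, Summable fun p : ZdPlaquette d =>
      |isoJ τ κ (p, q)| * exp (t * (‖p.1 - q.1‖ + 1)) := fun q =>
    Summable.of_nonneg_of_le (fun p => hw0 (p, q)) (fun p => abs_isoJ_mul_exp_le hκ0 ht (p, q)) (hct q).1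
  have hmem := memBallZdS_plaqPairCoupling (J := isoJ τ κ) hd hN ht
    (K₀ := |τ| * (numOrient d * ((1 + κ) / (1 - κ)) ^ d)) (K₀' := |τ| * (numOrient d * ((1 + κ) / (1 - κ)) ^ d))
    (Kt := |τ| * exp t * (numOrient d * ((1 + κ * exp t) / (1 - κ * exp t)) ^ d))
    (Kt' := |τ| * exp t * (numOrient d * ((1 + κ * exp t) / (1 - κ * exp t)) ^ d))
    (by positivity) (by positivity) (by positivity) (by positivity)
    hrow₀ (fun p => by simp_rw [habs]; exact (hr0 p).2) hcol₀ (fun q => by simp_rw [habs]; exact (hc0 q).2)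
    hrowt (fun p => ((hrowt p).tsum_le_tsum (fun q => abs_isoJ_mul_exp_le hκ0 ht (p, q)) (hrt p).1).trans (hrt p).2)
    hcolt (fun q => ((hcolt q).tsum_le_tsum (fun p => abs_isoJ_mul_exp_le hκ0 ht (p, q)) (hct q).1).trans (hct q).2)
  have ha : 4 * ((d : ℝ) - 1) * (|τ| * (numOrient d * ((1 + κ) / (1 - κ)) ^ d) +
      |τ| * (numOrient d * ((1 + κ) / (1 - κ)) ^ d)) =
      8 * ((d : ℝ) - 1) * numOrient d * |τ| * ((1 + κ) / (1 - κ)) ^ d := by ring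
  have hΛ : 8 * ((d : ℝ) - 1) * (exp t * (|τ| * (numOrient d * ((1 + κ) / (1 - κ)) ^ d) +
      |τ| * (numOrient d * ((1 + κ) / (1 - κ)) ^ d)) +
      (|τ| * exp t * (numOrient d * ((1 + κ * exp t) / (1 - κ * exp t)) ^ d) +
        |τ| * exp t * (numOrient d * ((1 + κ * exp t) / (1 - κ * exp t)) ^ d))) / Real.sqrt N =
      16 * ((d : ℝ) - 1) * numOrient d * |τ| * exp t *
        (((1 + κ) / (1 - κ)) ^ d + ((1 + κ * exp t) / (1 - κ * exp t)) ^ d) / Real.sqrt N := by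
    congr 1; ring
  rw [ha, hΛ] at hmem
  exact hmem

/-! ### Infinite range -/

/-- At `U ≡ 1` the member's term on the carrier of `(p, q)` is at least `τ κ^{‖x_p - x_q‖₁}` (`τ, κ ≥ 0`). -/
theorem le_isotropicPairWitness_code_one (hN : 1 ≤ N) (hτ : 0 ≤ τ) (hκ : 0 ≤ κ) (i : PlaqPairIdx d) :
    τ * κ ^ l1 (i.1.1 - i.2.1) ≤
      isotropicPairWitness N τ κ (plaqPairCode i) (1 : LGConfig d (Matrix.specialUnitaryGroup (Fin N) ℂ)) := by
  unfold isotropicPairWitness plaqPairCoupling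
  rw [indexedPotential_apply]
  have hterm : ∀ j : PlaqPairIdx d, plaqPairTerm N (isoJ τ κ) j (1 : LGConfig d (Matrix.specialUnitaryGroup (Fin N) ℂ)) =
      τ * κ ^ l1 (j.1.1 - j.2.1) := fun j => by
    unfold plaqPairTerm isoJ; rw [plaqObsN_one hN, plaqObsN_one hN, mul_one, mul_one]
  simp_rw [hterm]
  exact Finset.single_le_sum (f := fun j : PlaqPairIdx d => τ * κ ^ l1 (j.1.1 - j.2.1)) (fun j _ => by positivity)
    ((mem_plaqPairFib _ _).2 rfl)

/-- **The isotropic member lies in NO tier-1 ball** (`τ, κ > 0`, `d ≥ 2`): for every range `R` some active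
carrier contains two links at distance `> R`. -/
theorem not_memBallZd_isotropicPairWitness (hd : 2 ≤ d) (hN : 1 ≤ N) (hτ : 0 < τ) (hκ : 0 < κ) (ε₀ ε₁ R : ℝ)
    (supp : Finset (ZdEdge d) → Finset (Finset (ZdEdge d))) :
    ¬ MemBallZd ε₀ ε₁ R (isotropicPairWitness (d := d) N τ κ) supp := by
  intro hW
  set a : Fin d := ⟨0, by omega⟩ with ha
  set b : Fin d := ⟨1, by omega⟩ with hb
  have hab : a < b := by simp [ha, hb, Fin.lt_def]
  set p : ZdPlaquette d := ((0 : Site d), ⟨(a, b), hab⟩) with hp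
  set q : ZdPlaquette d := ((0 : Site d) + axialShift a ⌈R⌉₊, ⟨(a, b), hab⟩) with hq
  set i : PlaqPairIdx d := (p, q) with hi
  have he : (p.1, p.2.1.1) ∈ plaqPairCode i := mem_union_left _ (fst_mem_plaquetteEdges p)
  have hy : (q.1, q.2.1.1) ∈ plaqPairCode i := mem_union_right _ (fst_mem_plaquetteEdges q)
  have hne : isotropicPairWitness N τ κ (plaqPairCode i) ≠ 0 := by
    intro h0
    have h1 := le_isotropicPairWitness_code_one hN hτ.le hκ.le i
    rw [h0] at h1
    exact absurd h1 (not_le.2 (by positivity))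
  have hX : plaqPairCode i ∈ supp {(p.1, p.2.1.1)} :=
    hW.supportedBy {(p.1, p.2.1.1)} (plaqPairCode i) ⟨(p.1, p.2.1.1), mem_inter.2 ⟨he, mem_singleton_self _⟩⟩ hne
  have hfar : R < ‖p.1 - q.1‖ := by
    have h := le_norm_fst_sub_partner_fst ((p, a, ⌈R⌉₊) : AxialIdx d)
    calc R ≤ ⌈R⌉₊ := Nat.le_ceil R
      _ < (⌈R⌉₊ : ℝ) + 1 := lt_add_one _
      _ ≤ _ := h
  exact absurd (hW.range _ _ hX he _ hy) (not_le.2 hfar)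

/-! ### A certified `SU(2)` row on `ℤ⁴` -/

/-- **Row (isotropic infinite-range member)**: `SU(2)` on `ℤ⁴` at `β_W = 1/16` plus ALL plaquette-pair
couplings `τ (1/10)^{‖x_p - x_q‖₁} (Re tr U_p/2)(Re tr U_q/2)` with `|τ| ≤ 1/10000`: exactly one DLR state,
clustering at rate `log (3/2)` — inside row `su2_rowS32_1_16` (`D_4 = 6`, `G_4(1/10) = (11/9)^4`,
`G_4(3/20) = (23/17)^4`; loads `a ≤ 0.0322 ≤ 0.372`, `Λ ≤ 0.1706 ≤ 0.186`). -/
theorem su2_isotropicPair_massGapS_1_16 {τ : ℝ} (hτ : |τ| ≤ 1 / 10000) :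
    PerturbedMassGapAtS 4 2 ((1 / 16 : ℝ) / 4) (isotropicPairWitness (d := 4) 2 τ (1 / 10)) := by
  have hq : exp (Real.log (3 / 2)) = 3 / 2 := Real.exp_log (by norm_num)
  have hmem := memBallZdS_isotropicPairWitness (d := 4) (N := 2) (τ := τ) (κ := 1 / 10) (t := Real.log (3 / 2))
    (by norm_num) (by norm_num) (by norm_num) (by norm_num) (Real.log_nonneg (by norm_num)) (by rw [hq]; norm_num)
  rw [hq, numOrient_four] at hmem
  have hs := sqrt_two_ge
  have hs0 : (0 : ℝ) < Real.sqrt 2 := by linarith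
  have hτ0 : 0 ≤ |τ| := abs_nonneg τ
  have hdiv : |τ| / Real.sqrt 2 ≤ (1 / 10000) / (141421 / 100000) := div_le_div₀ (by norm_num) hτ (by norm_num) hs
  refine su2_rowS32_1_16 _ (hmem.mono ?_ ?_)
  · push_cast; nlinarith
  · push_cast
    have heq : (16 : ℝ) * (4 - 1) * 6 * |τ| * (3 / 2) *
        (((1 + 1 / 10) / (1 - 1 / 10)) ^ 4 + ((1 + 1 / 10 * (3 / 2)) / (1 - 1 / 10 * (3 / 2))) ^ 4) / Real.sqrt 2 =
        16 * (4 - 1) * 6 * (3 / 2) *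
        (((1 + 1 / 10) / (1 - 1 / 10)) ^ 4 + ((1 + 1 / 10 * (3 / 2)) / (1 - 1 / 10 * (3 / 2))) ^ 4) * (|τ| / Real.sqrt 2) := by
      ring
    rw [heq]
    nlinarith [hdiv, div_nonneg hτ0 hs0.le]

end Summit.Ventures.YMGap.RobustBall
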